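import Mathlib
import Summits.Ventures.HodgeRepro2.Tier7.Target
import Summits.Ventures.HodgeRepro2.Tier7.Datum.CurveTensor

/-!
# Tier7/Datum/CurveTensorShadow — the `SurfaceShadow` on `A ⊗ A'` with the trivial Hecke group (t7-L1-p1)

`shadowA ρ β hβ1 : SurfaceShadow (HXA ρ β) Unit` as soon as `β` takes the value `1`: `H^{1,0} := alb(V) = V ⊗ 1`
(`alb` injective through the retraction `x ⊗ y ↦ y.r • x`), `H^{1,0} ∧ H^{1,0} = ℂ·(t ⊗ 1)` (a LINE — so with `G = Unit`
every subspace is Hecke-stable, the line is the only Hecke-irreducible subspace of `H^{2,0}`, and (H9)/(H10) hold),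
`bar` the antilinear swap, `∫` the coefficient of `t ⊗ t'`, `hr_pos` from `(t ⊗ 1)·bar(t ⊗ 1) = t ⊗ t'`. Generic lemmas
on lines (`eq_bot_or_eq_span_of_le_span`, `heckeIrred_span_singleton_unit` — adapted from t7-crit-1's datum of record,
credited). §8(d): NO. Author: t7-L1-p1.
-/

/-! ## Part B — the `SurfaceShadow` on `HXA` with the trivial Hecke group `G = Unit` (t7-L1-p1) -/

namespace Summit.Ventures.HodgeRepro2.Tier7.DatumA

open Summit.Ventures.HodgeRepro2.Tier7
open scoped TensorProduct

noncomputable section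

/-! ### lines: the submodule lattice of a one-dimensional subspace (generic) -/

section Line

variable {M : Type} [AddCommGroup M] [Module ℂ M]

/-- a subspace of a line is `⊥` or the line -/
theorem eq_bot_or_eq_span_of_le_span {a : M} {U : Submodule ℂ M}
    (hU : U ≤ Submodule.span ℂ {a}) : U = ⊥ ∨ U = Submodule.span ℂ {a} := by
  by_cases hb : U = ⊥
  · exact Or.inl hb
  · right
    obtain ⟨u, huU, hu0⟩ := Submodule.exists_mem_ne_zero_of_ne_bot hb
    obtain ⟨c, rfl⟩ := Submodule.mem_span_singleton.1 (hU huU)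
    have hc : c ≠ 0 := by rintro rfl; simp at hu0
    refine le_antisymm hU ?_
    rw [Submodule.span_le, Set.singleton_subset_iff]
    have : a = c⁻¹ • (c • a) := by rw [smul_smul, inv_mul_cancel₀ hc, one_smul]
    rw [this]
    exact U.smul_mem _ huU

/-- the line spanned by a non-zero vector is non-zero -/
theorem span_singleton_ne_bot {a : M} (ha : a ≠ 0) : Submodule.span ℂ {a} ≠ ⊥ :=
  Submodule.span_singleton_eq_bot.not.2 ha

end Line

/-! ### the trivial Hecke action -/

section Unit

variable {M : Type} [Ring M] [Algebra ℂ M]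

/-- with `G = Unit` every subspace is Hecke-stable -/
theorem heckeStable_unit (U : Submodule ℂ M) : HeckeStable Unit U := fun _ _ ha => ha

/-- with `G = Unit` a line is Hecke-irreducible (adapted from t7-crit-1's `heckeIrred_span_singleton`,
HOME/review/OBJECTION-Target-t7-crit-1.JunkModel-frozen.lean, credited) -/
theorem heckeIrred_span_singleton_unit {a : M} (ha : a ≠ 0) : HeckeIrred Unit (Submodule.span ℂ {a}) :=
  ⟨span_singleton_ne_bot ha, heckeStable_unit _, fun _ hW _ => eq_bot_or_eq_span_of_le_span hW⟩

/-- with `G = Unit` a Hecke-irreducible subspace of a line is the line -/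
theorem eq_span_of_irred_le_span {a : M} {U : Submodule ℂ M} (hU : HeckeIrred Unit U)
    (hle : U ≤ Submodule.span ℂ {a}) : U = Submodule.span ℂ {a} := by
  rcases eq_bot_or_eq_span_of_le_span hle with h | h
  · exact absurd h hU.1
  · exact h

end Unit

/-! ### the shadow -/

section Shadow

variable {V : Type} [AddCommGroup V] [Module ℂ V] (ρ : RealStr V) (β : V →ₗ[ℂ] V →ₗ[ℂ] ℂ)

/-- the pull-back `alb : V → HXA`, `v ↦ v ⊗ 1` (injective) -/
def albA : V →ₗ[ℂ] HXA ρ β :=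
  (Algebra.TensorProduct.includeLeft : Ahol β →ₐ[ℂ] HXA ρ β).toLinearMap ∘ₗ CurveAlg.ofV

/-- `alb v = v ⊗ 1` -/
theorem albA_apply (v : V) : albA ρ β v = CurveAlg.ofV v ⊗ₜ[ℂ] (1 : Aanti ρ β) := rfl

/-- the generator `t ⊗ 1` of `H^{1,0} ∧ H^{1,0}` -/
def tt : HXA ρ β := (CurveAlg.t : Ahol β) ⊗ₜ[ℂ] (1 : Aanti ρ β)

/-- the «retraction» `HXA → A`, `x ⊗ y ↦ y.r • x` (a left inverse of `includeLeft`) -/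
def retr : HXA ρ β →ₗ[ℂ] Ahol β :=
  TensorProduct.lift (LinearMap.mk₂ ℂ (fun (x : Ahol β) (y : Aanti ρ β) => y.r • x)
    (fun x x' y => smul_add _ _ _) (fun c x y => smul_comm _ _ _)
    (fun x y y' => by simp [add_smul]) (fun c x y => by simp [mul_smul]))

/-- `retr (x ⊗ y) = y.r • x` -/
theorem retr_tmul (x : Ahol β) (y : Aanti ρ β) : retr ρ β (x ⊗ₜ[ℂ] y) = y.r • x := by
  simp [retr]

/-- `retr ∘ alb = ofV` -/
theorem retr_albA (v : V) : retr ρ β (albA ρ β v) = CurveAlg.ofV v := by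
  rw [albA_apply, retr_tmul]; simp

/-- `alb` is injective -/
theorem albA_injective : Function.Injective (albA ρ β) := by
  intro v w h
  have := congrArg (retr ρ β) h
  rw [retr_albA, retr_albA] at this
  exact congrArg CurveAlg.v this

/-- `t ⊗ 1 ≠ 0` -/
theorem tt_ne_zero : tt ρ β ≠ 0 := by
  intro h
  have := congrArg (intA ρ β) (congrArg (fun z => z * (1 ⊗ₜ[ℂ] (CurveAlg.t : Aanti ρ β))) h)
  simp only [tt, Algebra.TensorProduct.tmul_mul_tmul, mul_one, one_mul, zero_mul, map_zero, intA_tmul,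
    CurveAlg.top_apply, CurveAlg.t_a] at this
  exact one_ne_zero this

/-- `alb v · alb w = β(v, w) · (t ⊗ 1)` -/
theorem albA_mul_albA (v w : V) : albA ρ β v * albA ρ β w = β v w • tt ρ β := by
  rw [albA_apply, albA_apply, Algebra.TensorProduct.tmul_mul_tmul, CurveAlg.ofV_mul_ofV, mul_one, tt,
    TensorProduct.smul_tmul']

/-- `bar (t ⊗ 1) = 1 ⊗ t'` -/
theorem barA_tt : barA ρ β (tt ρ β) = (1 : Ahol β) ⊗ₜ[ℂ] (CurveAlg.t : Aanti ρ β) := by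
  rw [tt, barA_tmul, map_one, conjHol_t]

/-- `(t ⊗ 1) · bar (t ⊗ 1) = t ⊗ t'` -/
theorem tt_mul_barA_tt : tt ρ β * barA ρ β (tt ρ β) = (CurveAlg.t : Ahol β) ⊗ₜ[ℂ] (CurveAlg.t : Aanti ρ β) := by
  rw [barA_tt, tt, Algebra.TensorProduct.tmul_mul_tmul, mul_one, one_mul]

/-- `bar (t ⊗ 1) = 1 ⊗ t'` -/
theorem barA_tt_mul_tt : barA ρ β (tt ρ β) * tt ρ β = (CurveAlg.t : Ahol β) ⊗ₜ[ℂ] (CurveAlg.t : Aanti ρ β) := by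
  rw [barA_tt, tt, Algebra.TensorProduct.tmul_mul_tmul, mul_one, one_mul]

/-- `∫ (t ⊗ 1) ∧ conj (t ⊗ 1) = 1` -/
theorem intA_tt_mul_barA_tt : intA ρ β (tt ρ β * barA ρ β (tt ρ β)) = 1 := by
  rw [tt_mul_barA_tt, intA_tmul]; simp

/-- `H^{1,0} := alb(V) = V ⊗ 1` -/
def H10A : Submodule ℂ (HXA ρ β) := LinearMap.range (albA ρ β)

/-- the line `ℂ · (t ⊗ 1)` -/
def lineA : Submodule ℂ (HXA ρ β) := Submodule.span ℂ {tt ρ β}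

/-- `t ⊗ 1` generates the line -/
theorem tt_mem_lineA : tt ρ β ∈ lineA ρ β := Submodule.mem_span_singleton_self _

/-- `H^{1,0} ∧ H^{1,0} = ℂ · (t ⊗ 1)` as soon as `β` takes the value `1` -/
theorem H10A_mul_H10A (hβ1 : ∃ v w, β v w = 1) : H10A ρ β * H10A ρ β = lineA ρ β := by
  apply le_antisymm
  · refine Submodule.mul_le.2 ?_
    rintro _ ⟨v, rfl⟩ _ ⟨w, rfl⟩
    rw [albA_mul_albA]
    exact Submodule.smul_mem _ _ (tt_mem_lineA ρ β)
  · obtain ⟨v, w, hvw⟩ := hβ1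
    rw [lineA, Submodule.span_le, Set.singleton_subset_iff]
    have : tt ρ β = albA ρ β v * albA ρ β w := by rw [albA_mul_albA, hvw, one_smul]
    rw [this]
    exact Submodule.mul_mem_mul (LinearMap.mem_range_self _ v) (LinearMap.mem_range_self _ w)

/-- membership in the line -/
theorem mem_lineA_iff (x : HXA ρ β) : x ∈ lineA ρ β ↔ ∃ c : ℂ, c • tt ρ β = x :=
  Submodule.mem_span_singleton

/-- **the shadow of the abelian-surface shape**: `G = Unit`, `H^{1,0} = V ⊗ 1`, `bar` the antilinear swap,
`∫` the coefficient of `t ⊗ t'`; every field of `SurfaceShadow` holds as soon as `β` takes the value `1`. -/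
def shadowA (hβ1 : ∃ v w, β v w = 1) : SurfaceShadow (HXA ρ β) Unit where
  H10 := H10A ρ β
  act_add := fun _ _ _ => rfl
  act_mul := fun _ _ _ => rfl
  act_smul := fun _ _ _ => rfl
  act_H10 := fun _ _ ha => ha
  bar := barA ρ β
  bar_add := barA_add ρ β
  bar_smul := barA_smul ρ β
  bar_mul := barA_mul ρ β
  bar_bar := barA_barA ρ β
  bar_act := fun _ _ => rfl
  intX := intA ρ β
  intX_act := fun _ _ => rfl
  intX_bar := intA_barA ρ β
  comm_H20 := by
    intro a ha b hb
    rw [H10A_mul_H10A ρ β hβ1, mem_lineA_iff] at ha hb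
    obtain ⟨c, rfl⟩ := ha
    obtain ⟨c', rfl⟩ := hb
    rw [barA_smul, smul_mul_smul_comm, smul_mul_smul_comm, tt_mul_barA_tt, barA_tt_mul_tt, mul_comm]
  hr_pos := by
    intro a ha ha0
    rw [H10A_mul_H10A ρ β hβ1, mem_lineA_iff] at ha
    obtain ⟨c, rfl⟩ := ha
    have hc : c ≠ 0 := by rintro rfl; simp at ha0
    rw [barA_smul, smul_mul_smul_comm, map_smul, intA_tt_mul_barA_tt, smul_eq_mul, mul_one,
      Complex.mul_conj]
    simp only [Complex.ofReal_re]
    exact Complex.normSq_pos.2 hc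
  H20_semisimple := by
    intro U hU _
    rw [H10A_mul_H10A ρ β hβ1] at hU ⊢
    rcases eq_bot_or_eq_span_of_le_span hU with h | h
    · subst h
      refine ⟨⟨lineA ρ β, le_rfl, heckeStable_unit _, bot_inf_eq _, bot_sup_eq _⟩, fun h => absurd rfl h⟩
    · subst h
      refine ⟨⟨⊥, bot_le, heckeStable_unit _, inf_bot_eq _, sup_bot_eq _⟩, fun _ => ?_⟩
      exact ⟨lineA ρ β, le_rfl, heckeIrred_span_singleton_unit (tt_ne_zero ρ β)⟩
  H20_multone := by
    intro U U' hU hU' hirr hirr' _ _ _ _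
    rw [H10A_mul_H10A ρ β hβ1] at hU hU'
    rw [eq_span_of_irred_le_span hirr hU, eq_span_of_irred_le_span hirr' hU']

end Shadow

end

end Summit.Ventures.HodgeRepro2.Tier7.DatumA
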